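import Summits.Ventures.LatticeQCDFlow.Exactness.RandomisedHMC
import HarnessLib

/-!
# Randomised trajectory lengths do not lift the free-field floor: `τ_int(M) ≥ 1/E_w[1 − cos Nθ] − ½ ≥ ξ²/(δ² E_w[N²]) − ½`

HONEST FRAMING: exact (Metropolis-corrected) sampling algorithms for lattice gauge theory;
figures of merit are autocorrelation/cost numbers at stated couplings and volumes; no
continuum-physics claim.  (SCALAR calibration rung S0-A: not a gauge result.)

Venture `LatticeQCDFlow` (cell pub-lqcd), topic `Exactness`; FANOUT row 2 (`s0-phi4`, HMC arm: the
dynamical exponent `z` of the magnetisation).  NEW WORK of the cell, composing `RandomisedHMC` (the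
randomised-length update `K̄ = Σ_N w_N K_N` is exact, reversible, contracting, with the `w`-averaged
mean-squared-jump floor) with `FreeFieldHMCZeroMode` / `FreeFieldHMCMagnetisationCSD` (the zero mode
of the free field through one trajectory: mean squared accepted jump `≤ V(1 − cos Nθ)/m²`, resonant
lengths return `M` exactly).  Nothing is cited as a fact.  Printed counterparts, NAMED ONLY:
Mackenzie 1989 (randomised trajectory lengths), Kennedy–Pendleton 1991/2001 (free-field HMC).

Setting: free field `S = Σ_x [Σ_μ (φ(σ_μ x) − φ_x)² + m² φ_x²]` (`J = shiftCoupling σ m²`, `λ = 0`,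
`m² > 0`), step size `δ > 0` in the stable regime `δ²·2m² < 4`, `θ = arccos(1 − δ² m²·(2/2))`, a
finitely supported law `w` of trajectory lengths (`w_N ≥ 0`, `Σ_{N∈S} w_N = 1`), `c_N = cos(Nθ)`,
`M = Σ_x φ_x`, `g = M − ⟨M⟩`, `ρ_g(k)` along `K̄ = hmcOpRandom J 0 δ S w`, `ξ² = 1/m²`.

## What is proved

* `free_random_resonance_frozen` — if EVERY length in the support is resonant (`w_N (1 − c_N) = 0` for
  all `N ∈ S`) the randomised exact chain never moves `M`: `K̄ F(M) = F(M)`; hence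
  `free_random_not_all_resonant` — under `ρ_g(1) < 1`, `Σ_N w_N (1 − c_N) > 0`.
* **`freeRandomHMC_tauInt_ge_magnetisation`** — THE THEOREM: summable autocorrelations with
  `ρ_g(1) < 1` ⇒ `τ_int(M) ≥ 1/(Σ_N w_N (1 − cos Nθ)) − ½`: the fixed-`N` floor
  `(1 + c)/(2(1 − c)) = 1/(1 − c) − ½` of `FreeFieldHMCMagnetisationCSD` with `1 − c` replaced by its
  `w`-AVERAGE.
* **`freeRandomHMC_tauInt_ge_corrLength`** — hence `τ_int(M) ≥ 1/(m² δ² Σ_N w_N N²) − ½ =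
  ξ²/E_w[T²] − ½` (`1 − cos Nθ ≤ N² δ² m²`): **`z ≥ 2` at fixed MEAN SQUARED trajectory length, for
  the exact randomised algorithm** — randomisation removes the resonances from the denominator
  (an average of `1 − cos Nθ` no longer vanishes unless every supported length is resonant) but not the
  diffusive law.

Reading for S0-A (no numerics implied): an HMC comparator with trajectory lengths drawn from any law
of second moment `E[T²]` needs at least `ξ²/E[T²] − ½` updates per independent magnetisation on the
free field; only `E[T²] ≳ ξ²` (trajectories of the order of the correlation length, Kennedy–Pendleton's
`z = 1` tuning) makes the floor `O(1)`.  NOT CLAIMED: `ρ_g(1) < 1` / summability for any run; `λ > 0`;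
state-dependent length laws; partial momentum refreshment; upper bounds.
-/

namespace Summit.Ventures.LatticeQCDFlow.Exactness

open Real MeasureTheory Filter Finset
open Summit.Ventures.LatticeQCDFlow.Scoring

section Free

variable {n : ℕ} {ι : Type*} [Fintype ι]

/-- **If every supported trajectory length is resonant, the randomised exact chain never moves `M`**:
`w_N (1 − cos Nθ) = 0` for all `N ∈ S` ⇒ `K̄ F(M) = F(M)` for every function `F` of the
magnetisation (free field, stable regime, `Σ w = 1`). -/
theorem free_random_resonance_frozen (σ : ι → Equiv.Perm (Fin (n + 1))) {m2 δ : ℝ} (hδ : 0 < δ)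
    (hm : 0 < m2) (hst : δ ^ 2 * (2 * m2) < 4) {S : Finset ℕ} {w : ℕ → ℝ}
    (hw1 : ∑ N ∈ S, w N = 1)
    (hres : ∀ N ∈ S, w N * (1 - Real.cos (N * Real.arccos (1 - δ ^ 2 * (2 * m2) / 2))) = 0)
    (F : ℝ → ℝ) (φ : Fin (n + 1) → ℝ) :
    hmcOpRandom (shiftCoupling σ m2) 0 δ S w (fun ψ => F (∑ x, ψ x)) φ = F (∑ x, φ x) := by
  unfold hmcOpRandom
  have e : ∀ N ∈ S, w N * hmcOpPhi4 (shiftCoupling σ m2) 0 δ N (fun ψ => F (∑ x, ψ x)) φ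
      = w N * F (∑ x, φ x) := by
    intro N hN
    rcases mul_eq_zero.mp (hres N hN) with h0 | hc
    · rw [h0, zero_mul, zero_mul]
    · have hc1 : Real.cos (N * Real.arccos (1 - δ ^ 2 * (2 * m2) / 2)) = 1 := by linarith
      have h := free_resonance_frozen σ hδ hm hst hc1 F 1 φ
      rw [Function.iterate_one] at h
      rw [h]
  rw [Finset.sum_congr rfl e, ← Finset.sum_mul, hw1, one_mul]

/-- **Hence, if `ρ_g(1) < 1`, not every supported length is resonant**: `Σ_N w_N (1 − cos Nθ) > 0`
(`w_N ≥ 0`). -/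
theorem free_random_not_all_resonant (σ : ι → Equiv.Perm (Fin (n + 1))) {m2 δ : ℝ} (hδ : 0 < δ)
    (hm : 0 < m2) (hst : δ ^ 2 * (2 * m2) < 4) {S : Finset ℕ} {w : ℕ → ℝ} (hw0 : ∀ N, 0 ≤ w N)
    (hw1 : ∑ N ∈ S, w N = 1)
    (hρ : (∫ φ, ((∑ x, φ x) - gibbsExpect (shiftCoupling σ m2) 0 (fun ψ => ∑ x, ψ x))
        * hmcOpRandom (shiftCoupling σ m2) 0 δ S w
            (fun ψ => (∑ x, ψ x) - gibbsExpect (shiftCoupling σ m2) 0 (fun ψ => ∑ x, ψ x)) φ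
        * gibbsWeight (shiftCoupling σ m2) 0 φ)
        / (∫ φ, ((∑ x, φ x) - gibbsExpect (shiftCoupling σ m2) 0 (fun ψ => ∑ x, ψ x)) ^ 2
          * gibbsWeight (shiftCoupling σ m2) 0 φ) < 1) :
    0 < ∑ N ∈ S, w N * (1 - Real.cos (N * Real.arccos (1 - δ ^ 2 * (2 * m2) / 2))) := by
  have hnn : ∀ N ∈ S, 0 ≤ w N * (1 - Real.cos (N * Real.arccos (1 - δ ^ 2 * (2 * m2) / 2))) :=
    fun N _ => mul_nonneg (hw0 N) (sub_nonneg.mpr (Real.cos_le_one _))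
  rcases (Finset.sum_nonneg hnn).lt_or_eq with hpos | hzero
  · exact hpos
  · exfalso
    have hres : ∀ N ∈ S, w N * (1 - Real.cos (N * Real.arccos (1 - δ ^ 2 * (2 * m2) / 2))) = 0 :=
      (Finset.sum_eq_zero_iff_of_nonneg hnn).mp hzero.symm
    have hZ := gibbsZ_pos_of_coercive hm (free_coercive σ m2)
    have hK : ∀ φ : Fin (n + 1) → ℝ, hmcOpRandom (shiftCoupling σ m2) 0 δ S w
        (fun ψ => (∑ x, ψ x) - gibbsExpect (shiftCoupling σ m2) 0 (fun ψ => ∑ x, ψ x)) φ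
        = (∑ x, φ x) - gibbsExpect (shiftCoupling σ m2) 0 (fun ψ => ∑ x, ψ x) :=
      fun φ => free_random_resonance_frozen σ hδ hm hst hw1 hres
        (fun t => t - gibbsExpect (shiftCoupling σ m2) 0 (fun ψ => ∑ x, ψ x)) φ
    simp only [hK] at hρ
    rw [free_totalField_mean σ hm] at hρ
    simp only [sub_zero] at hρ
    have hpos : 0 < ∫ φ : Fin (n + 1) → ℝ, (∑ x, φ x) ^ 2 * gibbsWeight (shiftCoupling σ m2) 0 φ := by
      rw [free_integral_totalField_sq σ hm]
      exact mul_pos (by positivity) hZ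
    have e : (∫ φ : Fin (n + 1) → ℝ, (∑ x, φ x) * (∑ x, φ x) * gibbsWeight (shiftCoupling σ m2) 0 φ)
        = ∫ φ : Fin (n + 1) → ℝ, (∑ x, φ x) ^ 2 * gibbsWeight (shiftCoupling σ m2) 0 φ :=
      integral_congr_ae (Eventually.of_forall fun φ => by dsimp only; ring)
    rw [e, div_self hpos.ne'] at hρ
    exact lt_irrefl _ hρ

/-- **RANDOMISED TRAJECTORY LENGTHS DO NOT LIFT THE FREE-FIELD FLOOR.**  Free field, every `m² > 0`,
`δ > 0` with `δ²·2m² < 4`, every volume and shift structure, every finitely supported law `w` of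
lengths (`w ≥ 0`, `Σ w = 1`); `g = M − ⟨M⟩` with summable autocorrelations and `ρ_g(1) < 1` under the
exact randomised update `hmcOpRandom J 0 δ S w`.  Then `τ_int(M) ≥ 1/(Σ_N w_N (1 − cos Nθ)) − ½`. -/
theorem freeRandomHMC_tauInt_ge_magnetisation (σ : ι → Equiv.Perm (Fin (n + 1))) {m2 δ : ℝ}
    (hδ : 0 < δ) (hm : 0 < m2) (hst : δ ^ 2 * (2 * m2) < 4) {S : Finset ℕ} {w : ℕ → ℝ}
    (hw0 : ∀ N, 0 ≤ w N) (hw1 : ∑ N ∈ S, w N = 1)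
    (hs : Summable fun k => (∫ φ, ((∑ x, φ x) - gibbsExpect (shiftCoupling σ m2) 0 (fun ψ => ∑ x, ψ x))
        * ((hmcOpRandom (shiftCoupling σ m2) 0 δ S w)^[k + 1]
            (fun ψ => (∑ x, ψ x) - gibbsExpect (shiftCoupling σ m2) 0 (fun ψ => ∑ x, ψ x))) φ
        * gibbsWeight (shiftCoupling σ m2) 0 φ)
        / ∫ φ, ((∑ x, φ x) - gibbsExpect (shiftCoupling σ m2) 0 (fun ψ => ∑ x, ψ x)) ^ 2
          * gibbsWeight (shiftCoupling σ m2) 0 φ)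
    (hρ : (∫ φ, ((∑ x, φ x) - gibbsExpect (shiftCoupling σ m2) 0 (fun ψ => ∑ x, ψ x))
        * hmcOpRandom (shiftCoupling σ m2) 0 δ S w
            (fun ψ => (∑ x, ψ x) - gibbsExpect (shiftCoupling σ m2) 0 (fun ψ => ∑ x, ψ x)) φ
        * gibbsWeight (shiftCoupling σ m2) 0 φ)
        / (∫ φ, ((∑ x, φ x) - gibbsExpect (shiftCoupling σ m2) 0 (fun ψ => ∑ x, ψ x)) ^ 2
          * gibbsWeight (shiftCoupling σ m2) 0 φ) < 1) :
    1 / (∑ N ∈ S, w N * (1 - Real.cos (N * Real.arccos (1 - δ ^ 2 * (2 * m2) / 2)))) - 1 / 2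
      ≤ tauInt (fun k => (∫ φ, ((∑ x, φ x) - gibbsExpect (shiftCoupling σ m2) 0 (fun ψ => ∑ x, ψ x))
        * ((hmcOpRandom (shiftCoupling σ m2) 0 δ S w)^[k]
            (fun ψ => (∑ x, ψ x) - gibbsExpect (shiftCoupling σ m2) 0 (fun ψ => ∑ x, ψ x))) φ
        * gibbsWeight (shiftCoupling σ m2) 0 φ)
        / ∫ φ, ((∑ x, φ x) - gibbsExpect (shiftCoupling σ m2) 0 (fun ψ => ∑ x, ψ x)) ^ 2
          * gibbsWeight (shiftCoupling σ m2) 0 φ) := by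
  set A : ℝ := ∑ N ∈ S, w N * (1 - Real.cos (N * Real.arccos (1 - δ ^ 2 * (2 * m2) / 2))) with hA
  have hApos : 0 < A := free_random_not_all_resonant σ hδ hm hst hw0 hw1 hρ
  have hco := free_coercive σ m2
  have hD : ∀ N ∈ S, ∫ z : (Fin (n + 1) → ℝ) × (Fin (n + 1) → ℝ),
      involAccept (phi4HmcEnergy (shiftCoupling σ m2) 0) (hmcProposal (shiftCoupling σ m2) 0 δ N) z
        * ((fun φ : Fin (n + 1) → ℝ => ∑ x, φ x) (hmcProposal (shiftCoupling σ m2) 0 δ N z).1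
          - (fun φ : Fin (n + 1) → ℝ => ∑ x, φ x) z.1) ^ 2
        * Real.exp (-phi4HmcEnergy (shiftCoupling σ m2) 0 z)
        ∂((volume : Measure (Fin (n + 1) → ℝ)).prod volume)
      ≤ (fun N : ℕ => ((n : ℝ) + 1) * (1 - Real.cos (N * Real.arccos (1 - δ ^ 2 * (2 * m2) / 2))) / m2) N
        * (momentumZ n * gibbsZ (shiftCoupling σ m2) 0) :=
    fun N _ => free_traj_msd_le σ hδ hm hst N
  have h := hmcRandom_tauInt_ge_of_msd_le hm hco δ hw0 hw1 polyObs_magnetisation hD hs hρ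
  have hvar : gibbsExpect (shiftCoupling σ m2) 0 (fun φ =>
      ((∑ x, φ x) - gibbsExpect (shiftCoupling σ m2) 0 (fun ψ => ∑ x, ψ x)) ^ 2)
      = ((n : ℝ) + 1) / (2 * m2) := by
    simp only [free_totalField_mean σ hm, sub_zero]
    exact free_totalField_sq σ hm
  rw [hvar] at h
  have hV : (0 : ℝ) < (n : ℝ) + 1 := by positivity
  have hsum : ∑ N ∈ S, w N * (((n : ℝ) + 1)
      * (1 - Real.cos (N * Real.arccos (1 - δ ^ 2 * (2 * m2) / 2))) / m2) = ((n : ℝ) + 1) / m2 * A := by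
    rw [hA, Finset.mul_sum]
    exact Finset.sum_congr rfl fun N _ => by ring
  rw [hsum] at h
  have e : 2 * (((n : ℝ) + 1) / (2 * m2)) / (((n : ℝ) + 1) / m2 * A) - 1 / 2 = 1 / A - 1 / 2 := by
    field_simp
  rw [e] at h
  exact h

/-- **`z ≥ 2` AT FIXED MEAN SQUARED TRAJECTORY LENGTH, FOR THE EXACT RANDOMISED ALGORITHM**: under the
same hypotheses, `τ_int(M) ≥ 1/(m² δ² Σ_N w_N N²) − ½` (`= ξ²/E_w[T²] − ½`). -/
theorem freeRandomHMC_tauInt_ge_corrLength (σ : ι → Equiv.Perm (Fin (n + 1))) {m2 δ : ℝ}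
    (hδ : 0 < δ) (hm : 0 < m2) (hst : δ ^ 2 * (2 * m2) < 4) {S : Finset ℕ} {w : ℕ → ℝ}
    (hw0 : ∀ N, 0 ≤ w N) (hw1 : ∑ N ∈ S, w N = 1)
    (hs : Summable fun k => (∫ φ, ((∑ x, φ x) - gibbsExpect (shiftCoupling σ m2) 0 (fun ψ => ∑ x, ψ x))
        * ((hmcOpRandom (shiftCoupling σ m2) 0 δ S w)^[k + 1]
            (fun ψ => (∑ x, ψ x) - gibbsExpect (shiftCoupling σ m2) 0 (fun ψ => ∑ x, ψ x))) φ
        * gibbsWeight (shiftCoupling σ m2) 0 φ)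
        / ∫ φ, ((∑ x, φ x) - gibbsExpect (shiftCoupling σ m2) 0 (fun ψ => ∑ x, ψ x)) ^ 2
          * gibbsWeight (shiftCoupling σ m2) 0 φ)
    (hρ : (∫ φ, ((∑ x, φ x) - gibbsExpect (shiftCoupling σ m2) 0 (fun ψ => ∑ x, ψ x))
        * hmcOpRandom (shiftCoupling σ m2) 0 δ S w
            (fun ψ => (∑ x, ψ x) - gibbsExpect (shiftCoupling σ m2) 0 (fun ψ => ∑ x, ψ x)) φ
        * gibbsWeight (shiftCoupling σ m2) 0 φ)
        / (∫ φ, ((∑ x, φ x) - gibbsExpect (shiftCoupling σ m2) 0 (fun ψ => ∑ x, ψ x)) ^ 2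
          * gibbsWeight (shiftCoupling σ m2) 0 φ) < 1) :
    1 / (m2 * δ ^ 2 * ∑ N ∈ S, w N * (N : ℝ) ^ 2) - 1 / 2
      ≤ tauInt (fun k => (∫ φ, ((∑ x, φ x) - gibbsExpect (shiftCoupling σ m2) 0 (fun ψ => ∑ x, ψ x))
        * ((hmcOpRandom (shiftCoupling σ m2) 0 δ S w)^[k]
            (fun ψ => (∑ x, ψ x) - gibbsExpect (shiftCoupling σ m2) 0 (fun ψ => ∑ x, ψ x))) φ
        * gibbsWeight (shiftCoupling σ m2) 0 φ)
        / ∫ φ, ((∑ x, φ x) - gibbsExpect (shiftCoupling σ m2) 0 (fun ψ => ∑ x, ψ x)) ^ 2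
          * gibbsWeight (shiftCoupling σ m2) 0 φ) := by
  set A : ℝ := ∑ N ∈ S, w N * (1 - Real.cos (N * Real.arccos (1 - δ ^ 2 * (2 * m2) / 2))) with hA
  have hApos : 0 < A := free_random_not_all_resonant σ hδ hm hst hw0 hw1 hρ
  have hmain := freeRandomHMC_tauInt_ge_magnetisation σ hδ hm hst hw0 hw1 hs hρ
  refine le_trans (sub_le_sub_right ?_ _) hmain
  -- `A ≤ m² δ² Σ w N²`, termwise from `1 − cos Nθ ≤ (Nδ)² (2m²)/2`
  have hle : A ≤ m2 * δ ^ 2 * ∑ N ∈ S, w N * (N : ℝ) ^ 2 := by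
    rw [hA, Finset.mul_sum]
    refine Finset.sum_le_sum fun N _ => ?_
    have h1 := one_sub_cos_traj_le (δ := δ) (w2 := 2 * m2) (by positivity) hst N
    calc w N * (1 - Real.cos (N * Real.arccos (1 - δ ^ 2 * (2 * m2) / 2)))
        ≤ w N * (((N : ℝ) * δ) ^ 2 * (2 * m2) / 2) := mul_le_mul_of_nonneg_left h1 (hw0 N)
      _ = m2 * δ ^ 2 * (w N * (N : ℝ) ^ 2) := by ring
  exact one_div_le_one_div_of_le hApos hle

end Free

end Summit.Ventures.LatticeQCDFlow.Exactness
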